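import Literature.Topology.FourManifolds.SphereFamilySurgeryReparam
import HarnessLib

/-!
# Surgery along a framed family of spheres: turning the fibre by a linear isometry

Topic `Literature/Topology/FourManifolds` (proved API for `SphereFamilySurgery.lean`, companion
of `SphereFamilySurgeryReparam.lean`, which reparametrises the SPHERE factor).  Milnor, *Lectures
on the h-cobordism theorem* (1965), Def. 3.11 (PDF p. 17): the surgered manifold `χ(V, φ)` only
depends on the characteristic embedding `φ : S^{λ-1} × OD^{n-λ} → V` through the identification
*"`φ(u, θv)` with `(θu, v)`"*; replacing `φ` by `φ ∘ (id × R)` for a linear isometry `R` of the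
FIBRE `ℝ^{n-λ}` (the same `R` over the whole family) therefore does not change `χ(V, φ)`: the new
piece `OD^λ × S^{n-λ-1}` is re-coordinatised by `(y, v) ↦ (y, R v)`.  (For `λ = 1`, `n - λ = 3`:
the `0`-surgery along a framed `S⁰` in a `3`-manifold is unchanged when BOTH feet are precomposed
with the same reflection of `ℝ³`; precomposing only one foot changes it — Kosinski,
*Differential Manifolds* (1993), VI (6.6): `Dᵐ ∪ H¹` is `S¹ × D^{m-1}` or the non-orientable
`D^{m-1}`-bundle over `S¹`.)  Everything here is proved:

* `ballTimesSphereFibreCongr R` — the self-diffeomorphism `(i, y, v) ↦ (i, y, R v)` of the new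
  piece `ι × OD^{k+1} × Sˡ`;
* `FramedSphereFamily.fibreCongr ν R` — the framed family `(u, w) ↦ φᵢ (u, R w)`; same spheres,
  cores and complement (`sphere_fibreCongr`, `cores_fibreCongr`, `complement_fibreCongr`);
* `FramedSphereFamily.IsSurgery.fibreCongr`, `FramedSphereFamily.IsSurgery.of_fibreCongr` —
  **surgery is invariant under turning the fibre**: `P` is obtained from `X` by surgery along `ν`
  iff along `ν.fibreCongr R`.

## References

* J. Milnor, *Lectures on the h-cobordism theorem*, Princeton (1965), Def. 3.11 (PDF p. 17).
  [MilnorHCobordism1965]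
* A. A. Kosinski, *Differential Manifolds* (1993), VI (6.6). [Kosinski1993]
-/

open scoped Manifold ContDiff Topology
open Set Function

noncomputable section

namespace Literature.Topology.FourManifolds

universe u

/-! ### Re-coordinatising the new piece in the sphere factor -/

section NewPiece

variable {ι : Type u} {k l : ℕ}

/-- The map `(i, y, v) ↦ (i, y, R v)` of `DiscreteIndex ι × (ℝᵏ⁺¹ × Sˡ)` for a linear isometry
`R` of `ℝˡ⁺¹` (acting on `Sˡ` by `sphereCongr`). [folklore] -/
def ballTimesSphereFibreMap (R : EuclideanSpace ℝ (Fin (l + 1)) ≃ₗᵢ[ℝ] EuclideanSpace ℝ (Fin (l + 1)))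
    (q : DiscreteIndex ι × (EuclideanSpace ℝ (Fin (k + 1)) ×
      (Metric.sphere (0 : EuclideanSpace ℝ (Fin (l + 1))) 1))) :
    DiscreteIndex ι × (EuclideanSpace ℝ (Fin (k + 1)) ×
      (Metric.sphere (0 : EuclideanSpace ℝ (Fin (l + 1))) 1)) :=
  (q.1, q.2.1, sphereCongr R q.2.2)

/-- Unfolding lemma. [folklore] -/
@[simp] theorem ballTimesSphereFibreMap_apply
    (R : EuclideanSpace ℝ (Fin (l + 1)) ≃ₗᵢ[ℝ] EuclideanSpace ℝ (Fin (l + 1)))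
    (q : DiscreteIndex ι × (EuclideanSpace ℝ (Fin (k + 1)) ×
      (Metric.sphere (0 : EuclideanSpace ℝ (Fin (l + 1))) 1))) :
    ballTimesSphereFibreMap R q = (q.1, q.2.1, sphereCongr R q.2.2) := rfl

/-- `(i, y, v) ↦ (i, y, R⁻¹ v)` inverts `(i, y, v) ↦ (i, y, R v)`. [folklore] -/
theorem ballTimesSphereFibreMap_symm_apply
    (R : EuclideanSpace ℝ (Fin (l + 1)) ≃ₗᵢ[ℝ] EuclideanSpace ℝ (Fin (l + 1)))
    (q : DiscreteIndex ι × (EuclideanSpace ℝ (Fin (k + 1)) ×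
      (Metric.sphere (0 : EuclideanSpace ℝ (Fin (l + 1))) 1))) :
    ballTimesSphereFibreMap (k := k) R.symm (ballTimesSphereFibreMap R q) = q :=
  Prod.ext rfl (Prod.ext rfl ((sphereCongr R).symm_apply_apply q.2.2))

/-- The map `(i, y, v) ↦ (i, y, R v)` is `C^∞`. [folklore] -/
theorem contMDiff_ballTimesSphereFibreMap
    (R : EuclideanSpace ℝ (Fin (l + 1)) ≃ₗᵢ[ℝ] EuclideanSpace ℝ (Fin (l + 1))) :
    ContMDiff ((𝓡 0).prod ((𝓡 (k + 1)).prod (𝓡 l))) ((𝓡 0).prod ((𝓡 (k + 1)).prod (𝓡 l))) ∞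
      (ballTimesSphereFibreMap (ι := ι) (k := k) R) :=
  contMDiff_fst.prodMk ((contMDiff_fst.comp contMDiff_snd).prodMk
    ((sphereCongr R).contMDiff.comp (contMDiff_snd.comp contMDiff_snd)))

/-- `(i, y, v) ↦ (i, y, R v)` preserves the new piece `{‖y‖ < 1}`. [folklore] -/
theorem ballTimesSphereFibreMap_mem
    (R : EuclideanSpace ℝ (Fin (l + 1)) ≃ₗᵢ[ℝ] EuclideanSpace ℝ (Fin (l + 1)))
    {q : DiscreteIndex ι × (EuclideanSpace ℝ (Fin (k + 1)) ×
      (Metric.sphere (0 : EuclideanSpace ℝ (Fin (l + 1))) 1))}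
    (hq : q ∈ ballTimesSphere ι k l) : ballTimesSphereFibreMap R q ∈ ballTimesSphere ι k l := by
  simpa [ballTimesSphereFibreMap] using hq

/-- **Turning the sphere factor of the new piece**: the self-diffeomorphism
`(i, y, v) ↦ (i, y, R v)` of `ι × OD^{k+1} × Sˡ` for a linear isometry `R` of `ℝˡ⁺¹`. [folklore] -/
def ballTimesSphereFibreCongr
    (R : EuclideanSpace ℝ (Fin (l + 1)) ≃ₗᵢ[ℝ] EuclideanSpace ℝ (Fin (l + 1))) :
    (↥(ballTimesSphere ι k l)) ≃ₘ⟮(𝓡 0).prod ((𝓡 (k + 1)).prod (𝓡 l)),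
      (𝓡 0).prod ((𝓡 (k + 1)).prod (𝓡 l))⟯ ↥(ballTimesSphere ι k l) where
  toFun b := ⟨ballTimesSphereFibreMap R b, ballTimesSphereFibreMap_mem R b.2⟩
  invFun b := ⟨ballTimesSphereFibreMap R.symm b, ballTimesSphereFibreMap_mem R.symm b.2⟩
  left_inv b := Subtype.ext (ballTimesSphereFibreMap_symm_apply R b.1)
  right_inv b := Subtype.ext (by
    have h := ballTimesSphereFibreMap_symm_apply (k := k) R.symm b.1
    rwa [LinearIsometryEquiv.symm_symm] at h)
  contMDiff_toFun := by
    rw [← ContMDiff.subtypeVal_comp_iff]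
    exact (contMDiff_ballTimesSphereFibreMap R).comp contMDiff_subtype_val
  contMDiff_invFun := by
    rw [← ContMDiff.subtypeVal_comp_iff]
    exact (contMDiff_ballTimesSphereFibreMap R.symm).comp contMDiff_subtype_val

/-- Unfolding lemma for `ballTimesSphereFibreCongr`. [folklore] -/
@[simp] theorem coe_ballTimesSphereFibreCongr_apply
    (R : EuclideanSpace ℝ (Fin (l + 1)) ≃ₗᵢ[ℝ] EuclideanSpace ℝ (Fin (l + 1)))
    (b : ↥(ballTimesSphere ι k l)) :
    ((ballTimesSphereFibreCongr R b : ↥(ballTimesSphere ι k l)) :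
        DiscreteIndex ι × (EuclideanSpace ℝ (Fin (k + 1)) ×
          (Metric.sphere (0 : EuclideanSpace ℝ (Fin (l + 1))) 1))) =
      ballTimesSphereFibreMap R b := rfl

end NewPiece

/-! ### Turning the fibre of a framed family -/

namespace FramedSphereFamily

section Congr

variable {EX HX : Type*} [NormedAddCommGroup EX] [NormedSpace ℝ EX] [TopologicalSpace HX]
  {IX : ModelWithCorners ℝ EX HX} {X : Type*} [TopologicalSpace X] [ChartedSpace HX X]
  {ι : Type u} {k m : ℕ} (ν : FramedSphereFamily IX X ι k m)

/-- **Turning the fibre by a linear isometry**: the framed family `(u, w) ↦ φᵢ (u, R w)` for a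
linear isometry `R` of the fibre `ℝᵐ` (the same for all members and all `u`), Milnor's freedom
`φ ↦ φ ∘ (id × R)` in the characteristic embedding. [cite: MilnorHCobordism1965, Def. 3.11 (PDF p. 17)] -/
def fibreCongr (R : EuclideanSpace ℝ (Fin m) ≃ₗᵢ[ℝ] EuclideanSpace ℝ (Fin m)) :
    FramedSphereFamily IX X ι k m where
  toFun i := ν.toFun i ∘
    (Diffeomorph.refl (𝓡 k) (Metric.sphere (0 : EuclideanSpace ℝ (Fin (k + 1))) 1) ∞).prodCongr
      R.toContinuousLinearEquiv.toDiffeomorph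
  isSmoothEmbedding i := (ν.isSmoothEmbedding i).comp_diffeomorph _
  isOpen_range i := by
    rw [(EquivLike.surjective _).range_comp]
    exact ν.isOpen_range i
  disjoint_range i j hij := by
    change Disjoint (range (ν.toFun i ∘ _)) (range (ν.toFun j ∘ _))
    rw [(EquivLike.surjective _).range_comp, (EquivLike.surjective _).range_comp]
    exact ν.disjoint_range hij

/-- Unfolding lemma for the fibre-turned family. [folklore] -/
@[simp] theorem fibreCongr_toFun_apply (R : EuclideanSpace ℝ (Fin m) ≃ₗᵢ[ℝ] EuclideanSpace ℝ (Fin m))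
    (i : ι) (q : (Metric.sphere (0 : EuclideanSpace ℝ (Fin (k + 1))) 1) × EuclideanSpace ℝ (Fin m)) :
    (ν.fibreCongr R).toFun i q = ν.toFun i (q.1, R q.2) := rfl

/-- Turning the fibre does not change the core spheres (`R 0 = 0`). [folklore] -/
@[simp] theorem sphere_fibreCongr (R : EuclideanSpace ℝ (Fin m) ≃ₗᵢ[ℝ] EuclideanSpace ℝ (Fin m))
    (i : ι) : (ν.fibreCongr R).sphere i = ν.sphere i := by
  funext v
  simp [sphere]

/-- Turning the fibre does not change the union of the core spheres. [folklore] -/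
@[simp] theorem cores_fibreCongr (R : EuclideanSpace ℝ (Fin m) ≃ₗᵢ[ℝ] EuclideanSpace ℝ (Fin m)) :
    (ν.fibreCongr R).cores = ν.cores := by
  simp [cores]

/-- Turning the fibre does not change the complement of the core spheres. [folklore] -/
theorem complement_fibreCongr [T2Space X] [Finite ι]
    (R : EuclideanSpace ℝ (Fin m) ≃ₗᵢ[ℝ] EuclideanSpace ℝ (Fin m)) :
    (ν.fibreCongr R).complement = ν.complement := by
  apply TopologicalSpace.Opens.ext
  change ((ν.fibreCongr R).cores)ᶜ = ν.coresᶜ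
  rw [cores_fibreCongr]

/-- The identification of the (equal) complements of the cores of `ν.fibreCongr R` and of `ν`,
as a diffeomorphism of open submanifolds of `X`. [folklore] -/
def complementFibreCongr [T2Space X] [Finite ι]
    (R : EuclideanSpace ℝ (Fin m) ≃ₗᵢ[ℝ] EuclideanSpace ℝ (Fin m)) :
    (↥(ν.fibreCongr R).complement) ≃ₘ⟮IX, IX⟯ ↥ν.complement where
  toFun a := ⟨a.1, (ν.complement_fibreCongr R).le a.2⟩
  invFun a := ⟨a.1, (ν.complement_fibreCongr R).ge a.2⟩
  left_inv _ := rfl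
  right_inv _ := rfl
  contMDiff_toFun := contMDiff_inclusion (ν.complement_fibreCongr R).le
  contMDiff_invFun := contMDiff_inclusion (ν.complement_fibreCongr R).ge

/-- The identification of the complements is the identity on points of `X`. [folklore] -/
@[simp] theorem coe_complementFibreCongr_apply [T2Space X] [Finite ι]
    (R : EuclideanSpace ℝ (Fin m) ≃ₗᵢ[ℝ] EuclideanSpace ℝ (Fin m))
    (a : ↥(ν.fibreCongr R).complement) : ((ν.complementFibreCongr R a : ↥ν.complement) : X) = a :=
  rfl

/-- Two framed families with the same embeddings are equal. [folklore] -/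
theorem toFun_injective : Function.Injective
    (FramedSphereFamily.toFun : FramedSphereFamily IX X ι k m → _) := by
  intro ν₁ ν₂ h
  cases ν₁; cases ν₂
  cases h
  rfl

/-- Turning the fibre by `R` and then by `R⁻¹` gives the family back. [folklore] -/
theorem fibreCongr_fibreCongr_symm
    (R : EuclideanSpace ℝ (Fin m) ≃ₗᵢ[ℝ] EuclideanSpace ℝ (Fin m)) :
    (ν.fibreCongr R).fibreCongr R.symm = ν := by
  apply toFun_injective
  funext i q
  simp

end Congr

/-! ### Invariance of surgery -/

section Surgery

variable {EX HX : Type*} [NormedAddCommGroup EX] [NormedSpace ℝ EX] [TopologicalSpace HX]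
  {IX : ModelWithCorners ℝ EX HX} {X : Type*} [TopologicalSpace X] [ChartedSpace HX X]
  [IsManifold IX ∞ X] [T2Space X] {ι : Type u} [Finite ι] {k l : ℕ}
  (ν : FramedSphereFamily IX X ι k (l + 1))
  {EP HP : Type*} [NormedAddCommGroup EP] [NormedSpace ℝ EP] [TopologicalSpace HP]
  {IP : ModelWithCorners ℝ EP HP} {P : Type*} [TopologicalSpace P] [ChartedSpace HP P]

omit [IsManifold IX ∞ X] in
/-- Milnor's identification for the fibre-turned family is Milnor's identification for the
original family transported along `(i, y, v) ↦ (i, y, R v)` on the new piece: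
`φᵢ(u, R (θ v)) ~' (i, θ u, v)` iff `φᵢ(u, θ v') ~ (i, θ u, v')` with `v' = R v`.
[cite: MilnorHCobordism1965, Def. 3.11 (PDF p. 17)] -/
theorem sphereFamilySurgeryRel_fibreCongr_iff
    (R : EuclideanSpace ℝ (Fin (l + 1)) ≃ₗᵢ[ℝ] EuclideanSpace ℝ (Fin (l + 1)))
    (a : ↥(ν.fibreCongr R).complement) (b : ↥(ballTimesSphere ι k l)) :
    sphereFamilySurgeryRel (ν.fibreCongr R) a b ↔
      sphereFamilySurgeryRel ν (ν.complementFibreCongr R a) (ballTimesSphereFibreCongr R b) := by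
  simp only [sphereFamilySurgeryRel, fibreCongr_toFun_apply, coe_complementFibreCongr_apply,
    coe_ballTimesSphereFibreCongr_apply, ballTimesSphereFibreMap_apply, coe_sphereCongr, map_smul]

/-- **Surgery along a framed family is invariant under turning the fibre by a linear isometry**
(Milnor 1965, Def. 3.11: `χ(V, φ)` only sees the identification *"`φ(u, θv)` with `(θu, v)`"*,
which `(y, v) ↦ (y, R v)` transports): if `P` is obtained from `X` by surgery along `ν`, then also
along `ν.fibreCongr R`. [cite: MilnorHCobordism1965, Def. 3.11 (PDF p. 17)] -/
theorem IsSurgery.fibreCongr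
    (R : EuclideanSpace ℝ (Fin (l + 1)) ≃ₗᵢ[ℝ] EuclideanSpace ℝ (Fin (l + 1)))
    (h : ν.IsSurgery IP P) : (ν.fibreCongr R).IsSurgery IP P := by
  obtain ⟨jA, jB, hA, hAo, hB, hBo, hU, hR⟩ := h
  refine ⟨jA ∘ ν.complementFibreCongr R, jB ∘ ballTimesSphereFibreCongr R, hA.comp_diffeomorph _,
    ?_, hB.comp_diffeomorph _, ?_, ?_, fun a b => ?_⟩
  · rw [(EquivLike.surjective _).range_comp]
    exact hAo
  · rw [(EquivLike.surjective _).range_comp]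
    exact hBo
  · rw [(EquivLike.surjective _).range_comp, (EquivLike.surjective _).range_comp]
    exact hU
  · rw [Function.comp_apply, Function.comp_apply, hR, sphereFamilySurgeryRel_fibreCongr_iff]

/-- **Converse**: if `P` is obtained from `X` by surgery along `ν.fibreCongr R`, then also along
`ν` (turn back by `R⁻¹`). [cite: MilnorHCobordism1965, Def. 3.11 (PDF p. 17)] -/
theorem IsSurgery.of_fibreCongr
    (R : EuclideanSpace ℝ (Fin (l + 1)) ≃ₗᵢ[ℝ] EuclideanSpace ℝ (Fin (l + 1)))
    (h : (ν.fibreCongr R).IsSurgery IP P) : ν.IsSurgery IP P := by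
  have h' := IsSurgery.fibreCongr (ν.fibreCongr R) R.symm h
  rwa [fibreCongr_fibreCongr_symm] at h'

/-- `P` is obtained from `X` by surgery along `ν.fibreCongr R` iff along `ν`.
[cite: MilnorHCobordism1965, Def. 3.11 (PDF p. 17)] -/
theorem isSurgery_fibreCongr_iff
    (R : EuclideanSpace ℝ (Fin (l + 1)) ≃ₗᵢ[ℝ] EuclideanSpace ℝ (Fin (l + 1))) :
    (ν.fibreCongr R).IsSurgery IP P ↔ ν.IsSurgery IP P :=
  ⟨IsSurgery.of_fibreCongr ν R, IsSurgery.fibreCongr ν R⟩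

end Surgery

end FramedSphereFamily

end Literature.Topology.FourManifolds

end
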